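import Mathlib
import HarnessLib.Audit
import Summits.PneNP.PneNP.Theorems.ClusOshGap
import Summits.PneNP.PneNP.Theorems.ClusOshComplement
import Summits.PneNP.PneNP.Theorems.ClusOshReduction

/-!
# Route ClusUniversalCertificate — the one-block rung `(OSH-RUNG)` holds for UP-SETS (osh-P2.md §3 "special classes with one-line proofs")
(rung F-N1, cell pnp-ideate, crux `UniversalCertAll` = stmt-PneNP-19683; planner p1 g14, `lines/osh-P2.md` §3: "UP-SETS (F1(c): S = Σz; a(y) ≥ z(y) since
y + span{e_s : s ∈ Z(y)} ⊆ Y; dim ≤ m−1) — checked 166/166 up-sets of 𝔽₂⁴"; restricted-model combinatorics — nothing here bears on `P` versus `NP`)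

* `IsPointUpset Y` — `y ∈ Y`, `supp y ⊆ supp y'` ⟹ `y' ∈ Y`; `IsPointDownset`;
* `oshDown_eq_of_downset`, `oshS_eq_sum_supp_of_downset` — for a down-set the standard sets are the supports, `S(D) = Σ_d |d|` (compressions fix a lower family);
* `oshS_eq_sum_zeros_of_upset` — **`S(Y) = Σ_{y∈Y} z(y)` for an up-set** (complement duality `ClusOshComplement.oshS_compl`);
* `zeros_le_lexIncr_of_upset` — **`a_lex(y) ≥ z(y)`** (the flat `y + ⟨e_s : s ∈ Z(y)⟩` is lex-increasing inside an up-set);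
* `dimAt_le_pred_of_ne_univ` — `dim_Y(y) ≤ N − 1` unless `Y = V`;
* `oshRung_of_upset` — **`(OSH-RUNG)` for every up-set `Y`** (including `Y = V`).
-/

set_option linter.dupNamespace false -- `Summit.PneNP.PneNP.…`: summit = sub-problem name (D-0017 single-conjunct layout)

namespace Summit.PneNP.PneNP.Theorems.ClusHilbert.Osh

open Finset
open scoped FinsetFamily
open Summit.PneNP.PneNP.Theorems.ClusCube (V pt)
open Summit.PneNP.PneNP.Theorems.ClusHilbert (dimAt lexRank lexRank_lt_of_lead_zero exists_direction)

variable {N : ℕ}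

/-- `Y` is an UP-SET of points: closed under enlarging the support. -/
def IsPointUpset (Y : Finset (V N)) : Prop := ∀ y ∈ Y, ∀ y' : V N, supp y ⊆ supp y' → y' ∈ Y

/-- `Y` is a DOWN-SET of points: closed under shrinking the support. -/
def IsPointDownset (Y : Finset (V N)) : Prop := ∀ y ∈ Y, ∀ y' : V N, supp y' ⊆ supp y → y' ∈ Y

/-- The complement of an up-set is a down-set. -/
theorem isPointDownset_compl {Y : Finset (V N)} (h : IsPointUpset Y) : IsPointDownset Yᶜ := by
  intro y hy y' hy'
  rw [mem_compl] at hy ⊢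
  exact fun h' => hy (h y' h' y hy')

/-! ## Down-sets: the standard sets are the supports -/

/-- A lower family is fixed by down-compression. -/
theorem compression_eq_of_isLowerSet {𝒜 : Finset (Finset (Fin N))} (h : IsLowerSet (𝒜 : Set (Finset (Fin N)))) (a : Fin N) : 𝓓 a 𝒜 = 𝒜 := by
  ext s
  rw [Down.mem_compression]
  constructor
  · rintro (⟨hs, -⟩ | ⟨hs, hins⟩)
    · exact hs
    · exact absurd (h (subset_insert a s) hins) hs
  · intro hs
    exact Or.inl ⟨hs, h (erase_subset a s) hs⟩

/-- Hence all iterated compressions fix it. -/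
theorem downAll_eq_of_isLowerSet {𝒜 : Finset (Finset (Fin N))} (h : IsLowerSet (𝒜 : Set (Finset (Fin N)))) (l : List (Fin N)) : downAll l 𝒜 = 𝒜 := by
  induction l with
  | nil => rfl
  | cons a l ih =>
    show downAll l (𝓓 a 𝒜) = 𝒜
    rw [compression_eq_of_isLowerSet h, ih]

/-- The support family of a down-set of points is a lower family. -/
theorem isLowerSet_image_supp {D : Finset (V N)} (h : IsPointDownset D) : IsLowerSet ((D.image supp : Finset (Finset (Fin N))) : Set (Finset (Fin N))) := by
  intro s t hts hs
  rw [mem_coe, mem_image_supp] at hs ⊢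
  exact h _ hs _ (by rw [supp_pt, supp_pt]; exact hts)

/-- **For a down-set, `oshDown D` is the support family.** -/
theorem oshDown_eq_of_downset {D : Finset (V N)} (h : IsPointDownset D) : oshDown D = D.image supp :=
  downAll_eq_of_isLowerSet (isLowerSet_image_supp h) _

/-- **`S(D) = Σ_{d ∈ D} |supp d|` for a down-set.** -/
theorem oshS_eq_sum_supp_of_downset {D : Finset (V N)} (h : IsPointDownset D) : oshS D = ∑ d ∈ D, (supp d).card := by
  rw [oshS_eq_weight, oshDown_eq_of_downset h, sum_image fun x _ y _ hxy => supp_injective hxy]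

/-! ## Up-sets: `S = Σ z` -/

/-- `2 · Σ_{v ∈ V} z(v) = N · 2^N` (complementing the coordinates swaps zeros and support). -/
theorem two_mul_sum_zeros_univ : 2 * ∑ v : V N, (zeros v).card = N * 2 ^ N := by
  classical
  -- `v ↦ 1 + v` swaps `zeros` and `supp`
  have key : ∀ z : ZMod 2, z = 0 ↔ ¬ (1 + z = 0) := by decide
  have hswap : ∑ v : V N, (zeros v).card = ∑ v : V N, (supp v).card := by
    refine Fintype.sum_equiv (Equiv.addLeft (fun _ => (1 : ZMod 2))) _ _ fun v => ?_
    congr 1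
    ext i
    unfold zeros supp
    simp only [mem_filter, mem_univ, true_and, Equiv.coe_addLeft, Pi.add_apply, ne_eq]
    exact key (v i)
  have htot : ∑ v : V N, ((supp v).card + (zeros v).card) = N * 2 ^ N := by
    rw [sum_congr rfl fun v _ => card_supp_add_card_zeros v, sum_const, card_univ, Fintype.card_fun, ZMod.card, Fintype.card_fin, smul_eq_mul, mul_comm]
  rw [two_mul]
  conv_lhs => arg 1; rw [hswap]
  rw [← sum_add_distrib, htot]

/-- **`S(Y) = Σ_{y ∈ Y} z(y)` for an up-set.** -/
theorem oshS_eq_sum_zeros_of_upset {Y : Finset (V N)} (h : IsPointUpset Y) : oshS Y = ∑ y ∈ Y, (zeros y).card := by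
  classical
  have hD := oshS_eq_sum_supp_of_downset (isPointDownset_compl h)
  have hc := oshS_compl Yᶜ
  rw [compl_compl] at hc
  -- `2 S(Y) + 2 N |Yᶜ| = 2 S(Yᶜ) + N 2^N` and `S(Yᶜ) = Σ_{Yᶜ} |supp|`
  have hz := two_mul_sum_zeros_univ (N := N)
  have hsplit : ∑ v : V N, (zeros v).card = ∑ y ∈ Y, (zeros y).card + ∑ y ∈ Yᶜ, (zeros y).card :=
    (sum_add_sum_compl Y _).symm
  have hcz : ∑ y ∈ Yᶜ, (zeros y).card + ∑ y ∈ Yᶜ, (supp y).card = N * Yᶜ.card := by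
    rw [← sum_add_distrib]
    rw [show ∑ y ∈ Yᶜ, ((zeros y).card + (supp y).card) = ∑ y ∈ Yᶜ, N from
      sum_congr rfl fun y _ => by rw [add_comm]; exact card_supp_add_card_zeros y]
    rw [sum_const, smul_eq_mul, mul_comm]
  omega

/-! ## Up-sets: `a_lex ≥ z` -/

/-- The coordinate flat `⟨e_s : s ∈ Z(y)⟩` is lex-increasing at `y` inside an up-set. -/
theorem zeros_le_lexIncr_of_upset {Y : Finset (V N)} (h : IsPointUpset Y) {y : V N} (hy : y ∈ Y) : (zeros y).card ≤ lexIncr Y y := by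
  classical
  let U : Submodule (ZMod 2) (V N) := Submodule.span (ZMod 2) (Set.range fun s : zeros y => Pi.basisFun (ZMod 2) (Fin N) (s : Fin N))
  -- vectors of `U` vanish on the support of `y`
  have hvan : ∀ u ∈ U, ∀ i, y i ≠ 0 → u i = 0 := by
    intro u hu i hi
    refine Submodule.span_induction (p := fun u _ => u i = 0) ?_ rfl (fun a b _ _ ha hb => by rw [Pi.add_apply, ha, hb, add_zero])
      (fun c a _ ha => by rw [Pi.smul_apply, ha, smul_zero]) hu
    rintro _ ⟨s, rfl⟩
    have hs : y s = 0 := by have := s.2; unfold zeros at this; exact (mem_filter.1 this).2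
    show (Pi.basisFun (ZMod 2) (Fin N)) (s : Fin N) i = 0
    rw [Pi.basisFun_apply]
    exact Pi.single_eq_of_ne (fun his : i = (s : Fin N) => hi (by rw [his]; exact hs)) _
  have hdim : Module.finrank (ZMod 2) U = (zeros y).card := by
    have hli : LinearIndependent (ZMod 2) (fun s : zeros y => Pi.basisFun (ZMod 2) (Fin N) (s : Fin N)) :=
      (Pi.basisFun (ZMod 2) (Fin N)).linearIndependent.comp (fun s : zeros y => (s : Fin N)) Subtype.val_injective
    rw [finrank_span_eq_card hli, Fintype.card_coe]
  rw [← hdim]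
  refine finrank_le_lexIncr Y y U (fun u hu => h y hy _ fun i hi => ?_) (fun u hu hu0 => ?_)
  · unfold supp at hi ⊢
    rw [mem_filter] at hi ⊢
    refine ⟨mem_univ _, ?_⟩
    rw [Pi.add_apply, hvan u hu i hi.2, add_zero]; exact hi.2
  · -- the leading one of `u` sits at a zero of `y`
    have hex : ∃ i, u i ≠ 0 := by
      by_contra hno; push Not at hno; exact hu0 (funext hno)
    set S := univ.filter (fun i => u i ≠ 0) with hSdef
    have hSne : S.Nonempty := by obtain ⟨i, hi⟩ := hex; exact ⟨i, mem_filter.2 ⟨mem_univ _, hi⟩⟩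
    have ht : u (S.min' hSne) ≠ 0 := (mem_filter.1 (min'_mem S hSne)).2
    refine lexRank_lt_of_lead_zero (t := S.min' hSne) (fun i hi => ?_) ht ?_
    · by_contra hui
      exact (lt_irrefl _) (lt_of_lt_of_le hi (min'_le S i (mem_filter.2 ⟨mem_univ _, hui⟩)))
    · by_contra hyt
      exact ht (hvan u hu _ hyt)

/-! ## Dimension cap -/

/-- `dim_Y(y) ≤ N − 1` unless `Y` is everything. -/
theorem dimAt_le_pred_of_ne_univ {Y : Finset (V N)} (hY : Y ≠ univ) {y : V N} (hy : y ∈ Y) : dimAt Y y ≤ N - 1 := by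
  obtain ⟨W, hW, hk⟩ := exists_direction Y hy
  have hle : Module.finrank (ZMod 2) W ≤ N := (Submodule.finrank_le W).trans (by rw [Module.finrank_pi, Fintype.card_fin])
  by_contra hlt
  rw [← hk] at hlt
  have hN : Module.finrank (ZMod 2) W = Module.finrank (ZMod 2) (V N) := by rw [Module.finrank_pi, Fintype.card_fin]; omega
  have htop : W = ⊤ := Submodule.eq_top_of_finrank_eq hN
  apply hY
  refine eq_univ_of_forall fun v => ?_
  have := hW (v - y) (htop ▸ Submodule.mem_top)
  rwa [add_sub_cancel] at this

/-! ## The rung for up-sets -/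

/-- **`(OSH-RUNG)` holds for every up-set `Y`.** -/
theorem oshRung_of_upset {Y : Finset (V N)} (h : IsPointUpset Y) :
    oshS Y + ∑ y ∈ Y, dimAt Y y ≤ (N - 1) * Y.card + ∑ y ∈ Y, lexIncr Y y + (if Y = univ then 2 ^ N else 0) := by
  classical
  rw [oshS_eq_sum_zeros_of_upset h]
  have ha : ∑ y ∈ Y, (zeros y).card ≤ ∑ y ∈ Y, lexIncr Y y := sum_le_sum fun y hy => zeros_le_lexIncr_of_upset h hy
  by_cases hY : Y = univ
  · subst hY
    rw [if_pos rfl]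
    have hdim : ∑ y ∈ (univ : Finset (V N)), dimAt univ y ≤ N * (univ : Finset (V N)).card :=
      (sum_le_sum fun y _ => dimAt_le univ y).trans (by rw [sum_const, smul_eq_mul, mul_comm])
    have hcard : (univ : Finset (V N)).card = 2 ^ N := by rw [card_univ, Fintype.card_fun, ZMod.card, Fintype.card_fin]
    rw [hcard] at hdim ⊢
    have : N * 2 ^ N ≤ (N - 1) * 2 ^ N + 2 ^ N := by
      rcases Nat.eq_zero_or_pos N with h0 | hpos
      · subst h0; simp
      · have := Nat.sub_one_mul N (2 ^ N)
        have h2 : 2 ^ N ≤ N * 2 ^ N := Nat.le_mul_of_pos_left _ hpos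
        omega
    omega
  · rw [if_neg hY, add_zero]
    have hdim : ∑ y ∈ Y, dimAt Y y ≤ (N - 1) * Y.card :=
      (sum_le_sum fun y hy => dimAt_le_pred_of_ne_univ hY hy).trans (by rw [sum_const, smul_eq_mul, mul_comm])
    omega

end Summit.PneNP.PneNP.Theorems.ClusHilbert.Osh
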